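import Mathlib
import Summits.Ventures.PercRepro2.TypedSepTwoOSupport
import Summits.Ventures.PercRepro2.TypedSepTwoBTheorem

/-!
# The typed (SEP-2) zero, III′ (a₃ on the o-side) and the full class (blind cell PercRepro2,
p3 g6, 2026-08-25; `proofs/P3-BRIDGE.md` §11.22)

On a (SEP-2) split with `a₃` on the o-side (`SplitO`) the kernel `K₃` is a side kernel
(`K3_eq_sideO`; the b-side, with its 3-bit state, plays the A-role), its doubly symmetrised form
is `dsymO` on the side states, which vanishes identically (`dsymO_eq_zero`); hence **every typed
base vanishes**: `typedCount_eq_zero_of_splitO`, `HasSepTwoO`, and the FULL CLASS `HasSepTwo :=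
HasSepTwoB ∨ HasSepTwoO` («the roots separate `o` from `b`», `a₃` on either side) with
`typedCount_eq_zero_of_hasSepTwo` — the typed shadow of the lead's (SEP-2) identity.  Own work;
standard axioms.
-/

namespace Summit.Ventures.PercRepro2

open UnionCluster

namespace CovForm

namespace SepTwo

open OneTyped TypedA3 Untouched TypedFactor Separated RootBridge SepThree

section MainO

open Classical

variable {V : Type*} {E : Type*} [Fintype E] [DecidableEq E] {R : Type*} [Field R]
  [LinearOrder R] [IsStrictOrderedRing R]
variable (ends : E → Sym2 V) (o a₁ a₂ a₃ b : V)

/-- The kernel on the side restrictions (the b-side first): `KB` on the glued side states. -/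
noncomputable def sideΦO (WO WB : Set V) :
    Config E → Config E → Config E → Config E → Config E → Config E → R :=
  fun xb yb wb xo yo wo =>
    ((KB (gluedO (oSt2 ends b a₁ a₂ WB xb) (bSt ends a₁ a₂ a₃ o WO xo))
      (gluedO (oSt2 ends b a₁ a₂ WB yb) (bSt ends a₁ a₂ a₃ o WO yo))
      (gluedO (oSt2 ends b a₁ a₂ WB wb) (bSt ends a₁ a₂ a₃ o WO wo)) : ℤ) : R)

variable {ends o a₁ a₂ a₃ b}

omit [Fintype E] [LinearOrder R] [IsStrictOrderedRing R] in
/-- **`K₃` on the support of a (SEP-2) split (a₃ on the o-side) is a side kernel.** -/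
theorem K3_eq_sideO {WO WB : Set V} {F : Finset E} {z : Config E}
    (h : SplitO ends o a₁ a₂ a₃ b WO WB F z) {x y w : Config E}
    (hx : ∀ e, e ∉ F → x e = z e) (hy : ∀ e, e ∉ F → y e = z e) (hw : ∀ e, e ∉ F → w e = z e) :
    (K3 ends o a₁ a₂ a₃ b x y w : R) =
      sideKernel (sideF ends WB F) (sideF ends WO F) z (sideΦO ends o a₁ a₂ a₃ b WO WB) x y w := by
  rw [K3_eq_KB, st_eq_sepOSt h (le_zF hx), st_eq_sepOSt h (le_zF hy), st_eq_sepOSt h (le_zF hw)]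
  unfold sideKernel sideΦO
  rw [oSt2_restr WB hx, oSt2_restr WB hy, oSt2_restr WB hw, bSt_restr WO hx, bSt_restr WO hy,
    bSt_restr WO hw]

omit [Fintype E] [DecidableEq E] [LinearOrder R] [IsStrictOrderedRing R] in
/-- The doubly symmetrised side kernel is `dsymO` on the side states. -/
lemma symB_symA_sideΦO (WO WB : Set V) (xb yb wb xo yo wo : Config E) :
    symB (symA (sideΦO ends o a₁ a₂ a₃ b WO WB)) xb yb wb xo yo wo =
      ((dsymO (oSt2 ends b a₁ a₂ WB xb) (oSt2 ends b a₁ a₂ WB yb) (oSt2 ends b a₁ a₂ WB wb)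
        (bSt ends a₁ a₂ a₃ o WO xo) (bSt ends a₁ a₂ a₃ o WO yo)
        (bSt ends a₁ a₂ a₃ o WO wo) : ℤ) : R) := by
  unfold symB symA sideΦO dsymO psiO
  push_cast
  ring

omit [Fintype E] [DecidableEq E] [LinearOrder R] [IsStrictOrderedRing R] in
/-- The doubly symmetrised side kernel vanishes. -/
lemma symB_symA_sideΦO_eq_zero (WO WB : Set V) (xb yb wb xo yo wo : Config E) :
    symB (symA (sideΦO ends o a₁ a₂ a₃ b WO WB)) xb yb wb xo yo wo = (0 : R) := by
  rw [symB_symA_sideΦO, dsymO_eq_zero _ _ _ _ _ _ (validO_oSt2 WB xb) (validO_oSt2 WB yb)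
    (validO_oSt2 WB wb) (validB_bSt WO xo) (validB_bSt WO yo) (validB_bSt WO wo)]
  simp

/-- **THE TYPED (SEP-2) ZERO (a₃ on the o-side)**: every typed base of `K₃` vanishes on a split
support whose doors are the roots, with `b` alone on its side. -/
theorem typedCount_eq_zero_of_splitO {WO WB : Set V} (F : Finset E) (z : Config E) (τ : E → ℕ)
    (h : SplitO ends o a₁ a₂ a₃ b WO WB F z) :
    typedCount F z τ (K3 ends o a₁ a₂ a₃ b : Config E → Config E → Config E → R) = 0 := by
  set A := sideF ends WB F with hA
  set B := sideF ends WO F with hB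
  have hAF : A ⊆ F := Finset.filter_subset _ _
  have hBF : B ⊆ F := Finset.filter_subset _ _
  have hAB : Disjoint A B := by
    rw [Finset.disjoint_left]
    intro e heA heB
    simp only [hA, hB, sideF, Finset.mem_filter] at heA heB
    exact h.noloop e heA.1 ⟨heB.2, heA.2⟩
  have hker : typedCount F z τ (K3 ends o a₁ a₂ a₃ b : Config E → Config E → Config E → R) =
      typedCount F z τ (sideKernel A B z (sideΦO ends o a₁ a₂ a₃ b WO WB)) := by
    refine typedCount_congr_on_support F z τ fun x y w hc _ => ?_
    exact K3_eq_sideO h (fun e he => (hc e he).1) (fun e he => (hc e he).2.1)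
      (fun e he => (hc e he).2.2)
  rw [hker]
  exact typedCount_side_eq_zero F hAF hBF hAB z τ _
    (fun xb yb wb xo yo wo => symB_symA_sideΦO_eq_zero WO WB xb yb wb xo yo wo)

variable (ends o a₁ a₂ a₃ b)

/-- **The class**: the roots separate `{o, a₃}` from `b`. -/
def HasSepTwoO (F : Finset E) : Prop :=
  ∃ WO WB : Set V, SplitO ends o a₁ a₂ a₃ b WO WB F (fun _ => false)

/-- **Every typed base vanishes on `HasSepTwoO` at `z ≡ false`.** -/
theorem typedCount_eq_zero_of_hasSepTwoO (F : Finset E) (τ : E → ℕ)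
    (h : HasSepTwoO ends o a₁ a₂ a₃ b F) :
    typedCount F (fun _ => false) τ
      (K3 ends o a₁ a₂ a₃ b : Config E → Config E → Config E → R) = 0 := by
  obtain ⟨WO, WB, hs⟩ := h
  exact typedCount_eq_zero_of_splitO F _ τ hs

/-- **THE (SEP-2) CLASS**: the roots `a₁, a₂` separate `o` from `b` in the typed graph, with `a₃`
on either side. -/
def HasSepTwo (F : Finset E) : Prop :=
  HasSepTwoB ends o a₁ a₂ a₃ b F ∨ HasSepTwoO ends o a₁ a₂ a₃ b F

/-- **THE TYPED (SEP-2) ZERO**: every typed base of `K₃` vanishes on the (SEP-2) class at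
`z ≡ false` — the typed shadow of the lead's (SEP-2) identity `Gc ≡ 0`. -/
theorem typedCount_eq_zero_of_hasSepTwo (F : Finset E) (τ : E → ℕ)
    (h : HasSepTwo ends o a₁ a₂ a₃ b F) :
    typedCount F (fun _ => false) τ
      (K3 ends o a₁ a₂ a₃ b : Config E → Config E → Config E → R) = 0 := by
  rcases h with hB | hO
  · exact typedCount_eq_zero_of_hasSepTwoB ends o a₁ a₂ a₃ b F τ hB
  · exact typedCount_eq_zero_of_hasSepTwoO ends o a₁ a₂ a₃ b F τ hO

/-- Row 2′TRI (nonnegativity) on the (SEP-2) class, as a consequence of the exact zero. -/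
theorem typedCount_nonneg_of_hasSepTwo (F : Finset E) (τ : E → ℕ)
    (h : HasSepTwo ends o a₁ a₂ a₃ b F) :
    0 ≤ typedCount F (fun _ => false) τ
      (K3 ends o a₁ a₂ a₃ b : Config E → Config E → Config E → R) :=
  le_of_eq (typedCount_eq_zero_of_hasSepTwo ends o a₁ a₂ a₃ b F τ h).symm

end MainO

end SepTwo

end CovForm

end Summit.Ventures.PercRepro2
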